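import Literature.AlgebraicGeometry.Crystalline.PadicAnchorDefs
import Literature.AlgebraicGeometry.Surfaces.K3PeriodSurjectivity
import Literature.AlgebraicGeometry.Surfaces.K3Surface
import Literature.AlgebraicGeometry.HodgeTheory.GysinBaseChange

/-!
# Route NikulinTwinTransport · crux `TwinTwistorTransport` (stmt-HodgeConjecture-14393) · line `ordinary-prime-anchors` —
# DEFINITIONS: the `p`-adic twin model of a marked pair of K3 surfaces

The importable, sorry-free DEFINITIONS layer of the line `ordinary-prime-anchors`
(`Cruxes/TwinTwistorTransport/Lines/ordinary_prime_anchors.lean`, planner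
planner-cruxplan-stmt-HodgeConjecture-14393-ordinary-prime-ancho-0, lead reshape r1–r3), copied VERBATIM from the
kernel-checked skeleton so that the line's stubs typed over it (`stub_ordinaryDiscModels`, `stub_twinFormalSeeds`)
and the lead's glue / tightness lemmas can land under `Theorems/` and be consumed by name:

* `TwinModel μ S S' hS hS' η η' M` — a `p`-adic TWIN MODEL of the marked pair `(S, η; S', η')` of projective K3
  surfaces for the lattice map `M` (real carriers only: a prime `p > 10`, an algebraically closed residue field `k`,
  a smooth proper model `𝒲 / W(k)` of relative dimension `4`, projective over `W(k)`, a crystalline realization `C`,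
  an embedding `ι : K = W(k)[1/p] → ℂ` with `S × S' ≅ W_K ⊗_ι ℂ`, the period comparison `cmp`, the Betti twin class
  `γB` acting on `H²` as the twin similitude `η⁻¹ ∘ M ∘ η'`, its de Rham descent `γdR ∈ F²`, and the crystalline
  specialisation `u` with `bo u = γdR`), in the style of `Literature…Crystalline.PadicAnchor.Anchor`;
* `TwinModel.IsOrdinary` (unit-root rank `≥ 2` on `H²_cris(W₀)`: both K3 factors ordinary) and `TwinModel.IsGenuine`
  (the classical facts the composition consumes, named-fact pattern: rationality and Hodge type of `γB`, the period
  isomorphism, compatibility of `cmp` with cycle classes in both directions and with the Hodge filtration,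
  specialisation of cycles, Berthelot–Ogus 3.8, Bloch–Esnault–Kerz 1.3, `p`-torsion-freeness of `H^b(𝒪)`, `H^b(Ω¹)`);
* the proved glue `TwinModel.good_of_mem_span`: on a genuine model, `γ_dR ∈ K · A²(W_K)` ⟹ the twin similitude is
  induced by an algebraic class on `S × S'` (output clause (A) of the crux).

Design: nothing is asserted — `TwinModel` is data, `IsGenuine`/`IsOrdinary` are predicates with explicit subject,
consumed as hypotheses; no value of `CrystallineRealization` (hence of `TwinModel`) is constructible in the tree today
(wave-1 worker verdict on `stub_ordinaryTwinModel`: no junk value either — `iso` forces an honest `W(k)`-model of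
`S × S'` and `C` a full Weil cohomology on all smooth projective `k`-varieties). Universe `0` (`k : Type`) as in
`PadicAnchor`. References: Bloch–Esnault–Kerz, Invent. Math. 195 (2014) §1, Thm. 1.3; Berthelot–Ogus, Invent. Math. 72
(1983) Thm. 2.4, Cor. 2.5, Thm. 3.8; Fulton, Intersection theory §20.3; Nygaard, Invent. Math. 74 (1983) (ordinary K3).
-/

noncomputable section

-- `Summit.HodgeConjecture.HodgeConjecture.…` is the mandated summit-side namespace (single-conjunct summit), hence:
set_option linter.dupNamespace false

namespace Summit.HodgeConjecture.HodgeConjecture.Theorems.NikulinTwinTransport.OrdinaryPrimeAnchors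

open CategoryTheory MonoidalCategory
open scoped Isocrystal
open Literature.AlgebraicGeometry.Motives Literature.AlgebraicGeometry.HodgeTheory
open Literature.AlgebraicGeometry.Surfaces
open Literature.AlgebraicTopology.SingularHomology
open Literature.AlgebraicGeometry.Crystalline

/-- `Corr[μ, S, S', hS, hS' ; γ, y] = [γ]_* y = fst_* (snd^* y ∪ γ)`. Local notation only, verbatim from the line skeleton. -/
local notation3 (prettyPrint := false) "Corr[" μ ", " S ", " S' ", " hS ", " hS' " ; " γ ", " y "]" =>
  complexGysin μ
    (IsSmoothProjective.tensor_holds (IsK3Surface.isSmoothProjective hS)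
      (IsK3Surface.isSmoothProjective hS'))
    (IsK3Surface.isSmoothProjective hS) (SemiCartesianMonoidalCategory.fst S S')
    (rfl : 2 * 1 + 2 * 2 + 2 * 2 = 2 * 1 + 2 * (2 + 2))
    (cupProduct (rfl : 2 * 1 + 2 * 2 = 2 * 1 + 2 * 2)
      (complexBetti.map (SemiCartesianMonoidalCategory.snd S S') (2 * 1) y) γ)

/-- `Good[M, μ, S, S', hS, hS', η, η']`: the twin similitude `η⁻¹ ∘ M ∘ η'` is induced by an algebraic class. Local notation only,
verbatim from the line skeleton. -/
local notation3 (prettyPrint := false) "Good[" M ", " μ ", " S ", " S' ", " hS ", " hS' ", " η ", " η' "]" =>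
  ∃ γ ∈ algebraicClasses (MonoidalCategoryStruct.tensorObj S S') 2,
    ∀ y : complexBetti S' (2 * 1), (η : complexBetti S (2 * 1) ≃ₗ[ℂ] (K3Index → ℂ)).symm
      (M ((η' : complexBetti S' (2 * 1) ≃ₗ[ℂ] (K3Index → ℂ)) y)) = Corr[μ, S, S', hS, hS' ; γ, y]

/-! ## The `p`-adic twin model (posited INTERFACE, in the style of `Literature…Crystalline.PadicAnchor.Anchor`) -/

/-- A **`p`-adic twin model** of the marked pair `(S, η; S', η')` for the lattice similitude `M` (real carriers
only; which values are meant is recorded by `TwinModel.IsGenuine` / `TwinModel.IsOrdinary`): a prime `p > 10`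
(Bloch–Esnault–Kerz bound `d + 6 < p`, `d = 4`), an algebraically closed residue field `k` (intended `𝔽̄_p`), a smooth
proper model `𝒲 / W(k)` of relative dimension `4`, projective over `W(k)`, a crystalline realization `C` over `k`, an
embedding `ι : K = W(k)[1/p] → ℂ` with `S × S' ≅ W_K ⊗_ι ℂ`, the period comparison `cmp`, the BETTI TWIN CLASS `γB`
(a Künneth class of the twin similitude: `[γB]_* = η⁻¹ ∘ M ∘ η'`), its de Rham descent `γdR ∈ F² H⁴_dR(W_K/K)` to the
UNRAMIFIED field `K`, and its crystalline specialisation `u = bo⁻¹(γdR) ∈ H⁴_cris(W₀/W)_K`. -/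
structure TwinModel (μ : OrientationFamily) (S S' : SchemeOver ℂ) (hS : IsK3Surface S) (hS' : IsK3Surface S')
    (η : complexBetti S (2 * 1) ≃ₗ[ℂ] (K3Index → ℂ)) (η' : complexBetti S' (2 * 1) ≃ₗ[ℂ] (K3Index → ℂ))
    (M : Module.End ℂ (K3Index → ℂ)) where
  /-- the residue characteristic -/
  p : ℕ
  [prime : Fact p.Prime]
  /-- the Bloch–Esnault–Kerz bound `4 + 6 < p` -/
  large : 4 + 6 < p
  /-- the residue field (intended `𝔽̄_p`) -/
  k : Type
  [field : Field k]
  [charP : CharP k p]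
  [perfect : PerfectRing k p]
  [algClosed : IsAlgClosed k]
  /-- the model of `S × S'` over `W(k)` -/
  𝒲 : SchemeOver (WittVector p k)
  /-- `𝒲 / W(k)` is a smooth proper model of relative dimension `4` -/
  model : WittScheme.IsSmoothProperModel 4 𝒲
  /-- `𝒲` is projective over the ring `W(k)` -/
  projective : IsProjectiveOverRing 𝒲
  /-- crystalline realization over `k` (intended: the classical one) -/
  C : CrystallineRealization p k
  /-- the complex embedding of `K = W(k)[1/p]` -/
  ι : K(p, k) →+* ℂ
  /-- `S × S' ≅ W_K ⊗_{K,ι} ℂ` -/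
  iso : Nonempty (MonoidalCategoryStruct.tensorObj S S' ≅ (baseChangeHom ι).obj (WittScheme.genericFibre 𝒲))
  /-- period comparison (Grothendieck's algebraic de Rham theorem + GAGA + base change along `ι` + `iso`) -/
  cmp : ∀ i : ℕ, C.dR.obj (WittScheme.genericFibre 𝒲) i →ₛₗ[ι] complexBetti (MonoidalCategoryStruct.tensorObj S S') i
  /-- the Betti twin class -/
  γB : complexBetti (MonoidalCategoryStruct.tensorObj S S') (2 * 2)
  /-- `γB` acts on `H²` as the twin similitude `η⁻¹ ∘ M ∘ η'` -/
  act : ∀ y : complexBetti S' (2 * 1), η.symm (M (η' y)) = Corr[μ, S, S', hS, hS' ; γB, y]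
  /-- the de Rham twin class over `K` -/
  γdR : C.dR.obj (WittScheme.genericFibre 𝒲) (2 * 2)
  /-- its period is the Betti twin class -/
  cmp_γdR : cmp (2 * 2) γdR = γB
  /-- it lies in `F² H⁴_dR(W_K/K)` -/
  fil_γdR : γdR ∈ C.dR.fil (2 * 2) 2
  /-- the crystalline specialisation `sp(γ)` -/
  u : C.obj (WittScheme.specialFibre 𝒲) (2 * 2)
  /-- `bo (sp γ) = γ_dR` -/
  bo_u : C.bo 𝒲 (2 * 2) u = γdR

attribute [instance] TwinModel.prime TwinModel.field TwinModel.charP TwinModel.perfect TwinModel.algClosed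

namespace TwinModel

variable {μ : OrientationFamily} {S S' : SchemeOver ℂ} {hS : IsK3Surface S} {hS' : IsK3Surface S'}
  {η : complexBetti S (2 * 1) ≃ₗ[ℂ] (K3Index → ℂ)} {η' : complexBetti S' (2 * 1) ≃ₗ[ℂ] (K3Index → ℂ)}
  {M : Module.End ℂ (K3Index → ℂ)}

/-- **ORDINARITY** of the special fibre, typed on the real carrier `H²_cris(W₀/W)_K` with its Frobenius: there are two
`K`-independent Frobenius-FIXED vectors (unit-root rank `≥ 2`).  For `W₀ = S₀ × S₀″` a product of K3 surfaces over
`k = k̄` (`b₁ = 0`, so `H²(W₀) = H²(S₀) ⊕ H²(S₀″)`), each factor contributes unit-root rank `1` iff it is ORDINARY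
(height `1`) and `0` otherwise (Dieudonné–Manin; slope-`0` isocrystals over `k̄` are spanned by fixed vectors), so this
says: both K3 factors are ordinary — canonical lifts, Serre–Tate/canonical coordinates (Nygaard 1983, Deligne–Illusie)
are then available on the disc. -/
def IsOrdinary (D : TwinModel μ S S' hS hS' η η' M) : Prop :=
  ∃ v w : D.C.obj (WittScheme.specialFibre D.𝒲) 2,
    LinearIndependent K(D.p, D.k) ![v, w] ∧
      D.C.frobK (WittScheme.specialFibre D.𝒲) 2 v = v ∧ D.C.frobK (WittScheme.specialFibre D.𝒲) 2 w = w

/-- **GENUINENESS** of a twin model: the classical facts about (class, model, crystalline and de Rham realizations,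
Berthelot–Ogus map, period comparison) that the line consumes — named-fact pattern, theorems in print for the
CLASSICAL package: the twin class is a rational Hodge class; the period isomorphism; compatibility of `cmp` with cycle
classes (cycle classes of `W_K` are algebraic on `S × S'`) and with the Hodge filtration (the converse direction
"a `K`-rational de Rham class with algebraic period is a `K`-combination of classes of `K`-cycles" is NOT a theorem — Galois
may act non-trivially on the cycle classes of `W_{K̄}`, cf. the residual predicate `PadicAnchor.Anchor.CycleDescent` — and is
carried separately as `TwinModel.CycleDescent`, never assumed here); specialisation of cycles; Berthelot–Ogus 3.8; Bloch–Esnault–Kerz 1.3; `p`-torsion-freeness of `H^b(𝒲, 𝒪)`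
and `H^b(𝒲, Ω¹)` (Deligne–Illusie + Künneth for a product of K3 surfaces, `p ≥ 5`; `Ω²` has no carrier in the tree yet —
triage A2: the `d = 4` variant of `FormalLiftingFromClassLifting` needs all `H^b(Ω^a)` torsion-free). -/
structure IsGenuine (D : TwinModel μ S S' hS hS' η η' M) : Prop where
  /-- the twin class is rational … -/
  rational : IsRationalClass D.γB
  /-- … of Hodge type `(2,2)` -/
  hodgeType : IsOfHodgeType 4 (MonoidalCategoryStruct.tensorObj S S') (2 * 2) 2 2 D.γB
  /-- period isomorphism, spanning half -/
  periodSpan : ∀ i : ℕ, Submodule.span ℂ (Set.range (D.cmp i)) = ⊤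
  /-- … and injectivity -/
  periodInjective : ∀ i : ℕ, Function.Injective (D.cmp i)
  /-- cycle classes: the period of a rational algebraic de Rham class of `W_K` is algebraic on `S × S'` -/
  cycleCompatible : ∀ (r : ℕ) (x : D.C.dR.obj (WittScheme.genericFibre D.𝒲) (2 * r)),
    x ∈ D.C.dR.ratAlgebraicClasses (WittScheme.genericFibre D.𝒲) r →
      D.cmp (2 * r) x ∈ algebraicClasses (MonoidalCategoryStruct.tensorObj S S') r
  /-- Hodge filtration: `cmp (Fʳ H²ʳ_dR) ⊆ Fʳ H²ʳ_B` -/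
  filCompatible : ∀ (r : ℕ) (x : D.C.dR.obj (WittScheme.genericFibre D.𝒲) (2 * r)),
    x ∈ D.C.dR.fil (2 * r) r → D.cmp (2 * r) x ∈ PadicAnchor.bettiHodgeFil 4 (MonoidalCategoryStruct.tensorObj S S') r
  /-- specialisation of cycles (Fulton §20.3 + Gillet–Messing) at `D.C` -/
  specialization : PadicAnchor.SpecializationOfCycles D.C
  /-- Berthelot–Ogus 1983, Thm. 3.8 at `D.C` -/
  lineBundles : D.C.BerthelotOgusLineBundleLifting
  /-- Bloch–Esnault–Kerz 2014, Thm. 1.3 at `D.C` -/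
  bek : BlochEsnaultKerzLifting D.C
  /-- `H^b(𝒲, 𝒪)` has no `p`-torsion -/
  torsionFree_structureSheaf :
    ∀ (b : ℕ) (x : structureSheafCohomology D.𝒲.left b), (D.p : ℤ) • x = 0 → x = 0
  /-- `H^b(𝒲, Ω¹)` has no `p`-torsion -/
  torsionFree_hodgeOne : ∀ (b : ℕ) (x : hodgeCohomologyOne D.𝒲 b), (D.p : ℤ) • x = 0 → x = 0


/-- **CYCLE DESCENT at the twin model `D`** (the RESIDUAL predicate, exactly like `PadicAnchor.Anchor.CycleDescent`; NOT a field of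
`IsGenuine` and not a theorem for the classical package in general — with `L/K` finite Galois acting non-trivially on the cycle classes of
`W_L`, a `K`-rational class in their `L`-span need not lie in the `K`-span of classes of `K`-cycles): every `K`-rational de Rham class of `W_K`
whose period is algebraic on `S × S'` is a `K`-combination of classes of `K`-cycles. Consumed only as an explicit hypothesis (honesty lemma
`heart ⇐ HC + CycleDescent`). -/
def CycleDescent (D : TwinModel μ S S' hS hS' η η' M) : Prop :=
  ∀ (r : ℕ) (x : D.C.dR.obj (WittScheme.genericFibre D.𝒲) (2 * r)),
    D.cmp (2 * r) x ∈ algebraicClasses (MonoidalCategoryStruct.tensorObj S S') r →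
      x ∈ Submodule.span K(D.p, D.k)
        (D.C.dR.ratAlgebraicClasses (WittScheme.genericFibre D.𝒲) r :
          Set (D.C.dR.obj (WittScheme.genericFibre D.𝒲) (2 * r)))

/-- **Glue (proved): algebraic over `K` ⟹ Good.**  On a genuine twin model, if the de Rham twin class is a
`K`-combination of cycle classes of `W_K`, then the twin similitude `η⁻¹ ∘ M ∘ η'` is induced by an algebraic class on
`S × S'` — namely by the Betti twin class `γB = cmp γdR` itself (semilinear span + `cycleCompatible`; `algebraicClasses`
is a `ℂ`-subspace).  This is the only place the output clause (A) of the crux is produced; (R),(T),(H) follow inside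
`anchorAt_of_twinTransport`. -/
theorem good_of_mem_span (D : TwinModel μ S S' hS hS' η η' M) (hG : D.IsGenuine)
    (h : D.γdR ∈ Submodule.span K(D.p, D.k)
      (D.C.dR.ratAlgebraicClasses (WittScheme.genericFibre D.𝒲) 2 :
        Set (D.C.dR.obj (WittScheme.genericFibre D.𝒲) (2 * 2)))) :
    Good[M, μ, S, S', hS, hS', η, η'] := by
  have h1 := PadicAnchor.semilinear_apply_mem_span_image (D.cmp (2 * 2)) h
  rw [D.cmp_γdR] at h1
  have h2 : Submodule.span ℂ (D.cmp (2 * 2) ''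
      (D.C.dR.ratAlgebraicClasses (WittScheme.genericFibre D.𝒲) 2 :
        Set (D.C.dR.obj (WittScheme.genericFibre D.𝒲) (2 * 2)))) ≤
      algebraicClasses (MonoidalCategoryStruct.tensorObj S S') 2 := by
    refine Submodule.span_le.2 ?_
    rintro _ ⟨x, hx, rfl⟩
    exact hG.cycleCompatible 2 x hx
  exact ⟨D.γB, h2 h1, D.act⟩

end TwinModel

/-- **Registered sub-goal `twinModel_good_of_mem_span`** (the glue `TwinModel.good_of_mem_span` as ONE closed statement, all binders
explicit, no local notation): on a genuine twin model, if the de Rham twin class is a `K`-combination of cycle classes of `W_K`, then the twin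
similitude `η⁻¹ ∘ M ∘ η'` is induced by an algebraic class on `S × S'`. -/
theorem twinModel_good_of_mem_span : ∀ (μ : OrientationFamily) (S S' : SchemeOver ℂ) (hS : IsK3Surface S) (hS' : IsK3Surface S') (η : complexBetti S (2 * 1) ≃ₗ[ℂ] (K3Index → ℂ)) (η' : complexBetti S' (2 * 1) ≃ₗ[ℂ] (K3Index → ℂ)) (M : Module.End ℂ (K3Index → ℂ)) (D : TwinModel μ S S' hS hS' η η' M), D.IsGenuine → D.γdR ∈ Submodule.span K(D.p, D.k) (D.C.dR.ratAlgebraicClasses (WittScheme.genericFibre D.𝒲) 2 : Set (D.C.dR.obj (WittScheme.genericFibre D.𝒲) (2 * 2))) → ∃ γ ∈ algebraicClasses (MonoidalCategoryStruct.tensorObj S S') 2, ∀ y : complexBetti S' (2 * 1), η.symm (M (η' y)) = complexGysin μ (IsSmoothProjective.tensor_holds (IsK3Surface.isSmoothProjective hS) (IsK3Surface.isSmoothProjective hS')) (IsK3Surface.isSmoothProjective hS) (SemiCartesianMonoidalCategory.fst S S') (rfl : 2 * 1 + 2 * 2 + 2 * 2 = 2 * 1 + 2 * (2 + 2)) (cupProduct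 (rfl : 2 * 1 + 2 * 2 = 2 * 1 + 2 * 2) (complexBetti.map (SemiCartesianMonoidalCategory.snd S S') (2 * 1) y) γ) :=
  fun _ _ _ _ _ _ _ _ D hG h => D.good_of_mem_span hG h

end Summit.HodgeConjecture.HodgeConjecture.Theorems.NikulinTwinTransport.OrdinaryPrimeAnchors

end
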